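import Literature.AlgebraicTopology.SingularHomology.TwoPieceKappaLinear
import Literature.AlgebraicTopology.SingularHomology.CohomologyDisjointOpenCover
import Literature.AlgebraicTopology.SingularHomology.CupProductProofs
import Literature.AlgebraicTopology.SingularHomology.CohomologyOfPoint
import Literature.AlgebraicTopology.SingularHomology.CohomologyMayerVietorisExtend
import HarnessLib

/-!
# The Künneth splitting of `H*(U × S)` for sphere-like `S`, in cup form: the suspension ladder

A. Hatcher, *Algebraic Topology* (2002), Thm. 3.16 / Example 3.11 (`H*(X × Sᵐ; R) ≅ H*(X; R) ⊗ H*(Sᵐ; R)`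
by induction on `m` via Mayer–Vietoris for the two hemispheres), here for ARBITRARY spaces `U`
and coefficient rings, with `Sᵐ` replaced by any space reached by the same ladder: we say
`IsCupSphere R Z m g` (`g ∈ Hᵐ(Z; R)`) if for every space `U` and every `k`

  `(a, c) ↦ pr₁^* a + pr₂^* g ⌣ pr₁^* c : Hᵏ⁺ᵐ(U) × Hᵏ(U) → Hᵏ⁺ᵐ(U × Z)`   is bijective,

and `pr₁^* : Hᵏ(U) → Hᵏ(U × Z)` is bijective for `k < m`. We prove

* `isCupSphere_zero`: a space which is the disjoint union of two contractible open pieces is a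
  cup-sphere of level `0` (`g` = the indicator class of the second piece);
* `IsCupSphere.suspension`: **if `Y = A₁ ∪ A₂` with `A₁`, `A₂` open and contractible and
  `A₁ ∩ A₂` is a cup-sphere of level `m`, then `Y` is a cup-sphere of level `m + 1`**, with the
  class `g_Y = κ(pr₂^* g)` produced by the boundary–excision map `κ` of
  `TwoPieceProductCohomology` at `U = pt` (proof: the decomposition
  `Hⁱ⁺¹(U × Y) = pr₁^* Hⁱ⁺¹(U) ⊕ κ(Hⁱ(U × (A₁ ∩ A₂)))` of that file, the `H*(U × Y)`-linearity of
  `κ` (`TwoPieceKappaLinear`) and its naturality in `U`);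
* `IsCupSphere.of_homeomorph` / `of_homotopyEquiv`: transport.

With `ℝᵐ⁺¹ ∖ 0 = ` (two slit sets, meeting in `≃ ℝᵐ ∖ 0`) this yields the cup-form Künneth theorem
for `U × (ℝᴺ ∖ 0)` and `U × S²ⁿ⁻¹` (sequel `PuncturedCupSphere.lean`). Everything is proved; no named facts.

## References

* A. Hatcher, *Algebraic Topology*, CUP 2002, §3.2 Thm. 3.16, Example 3.11; §3.1 pp. 200–203. [HatcherAT2002]
-/

noncomputable section

open CategoryTheory Function Set

universe u

namespace Literature.AlgebraicTopology.SingularHomology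

variable (R : Type u) [CommRing R]

/-! ### Cup-spheres -/

/-- **The cup-form Künneth map** `(a, c) ↦ pr₁^* a + pr₂^* g ⌣ pr₁^* c : Hᵏ⁺ᵐ(U) × Hᵏ(U) → Hᵏ⁺ᵐ(U × Z)`.
[cite: HatcherAT2002, §3.2 Thm. 3.16] -/
def sphereSplit {Z : Type u} [TopologicalSpace Z] {m : ℕ} (g : singularCohomology R R Z m)
    (U : Type u) [TopologicalSpace U] (k : ℕ) :
    singularCohomology R R U (k + m) × singularCohomology R R U k → singularCohomology R R (U × Z) (k + m) := fun x ↦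
  singularCohomology.map R R (ContinuousMap.fst : C(U × Z, U)) (k + m) x.1 +
    cupProduct (Nat.add_comm m k) (singularCohomology.map R R (ContinuousMap.snd : C(U × Z, Z)) m g)
      (singularCohomology.map R R (ContinuousMap.fst : C(U × Z, U)) k x.2)

/-- `sphereSplit` unfolded. [folklore] -/
theorem sphereSplit_apply {Z : Type u} [TopologicalSpace Z] {m : ℕ} (g : singularCohomology R R Z m)
    (U : Type u) [TopologicalSpace U] (k : ℕ) (a : singularCohomology R R U (k + m)) (c : singularCohomology R R U k) :
    sphereSplit R g U k (a, c) = singularCohomology.map R R (ContinuousMap.fst : C(U × Z, U)) (k + m) a +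
      cupProduct (Nat.add_comm m k) (singularCohomology.map R R (ContinuousMap.snd : C(U × Z, Z)) m g)
        (singularCohomology.map R R (ContinuousMap.fst : C(U × Z, U)) k c) := rfl

/-- `sphereSplit` is additive (a group homomorphism). [folklore] -/
theorem sphereSplit_sub {Z : Type u} [TopologicalSpace Z] {m : ℕ} (g : singularCohomology R R Z m)
    (U : Type u) [TopologicalSpace U] (k : ℕ) (x x' : singularCohomology R R U (k + m) × singularCohomology R R U k) :
    sphereSplit R g U k (x - x') = sphereSplit R g U k x - sphereSplit R g U k x' := by
  obtain ⟨a, c⟩ := x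
  obtain ⟨a', c'⟩ := x'
  simp only [Prod.mk_sub_mk, sphereSplit_apply, map_sub]
  abel

/-- **Cup-spheres of level `m`**: spaces `Z` with a class `g ∈ Hᵐ(Z; R)` such that
`H*(U × Z) = pr₁^* H*(U) ⊕ pr₂^* g ⌣ pr₁^* H*⁻ᵐ(U)` for every space `U` (Künneth in cup form), and
`pr₁^*` bijective below degree `m`. [cite: HatcherAT2002, §3.2 Thm. 3.16] -/
structure IsCupSphere (Z : Type u) [TopologicalSpace Z] (m : ℕ) (g : singularCohomology R R Z m) : Prop where
  split : ∀ (U : Type u) [TopologicalSpace U] (k : ℕ), Bijective (sphereSplit R g U k)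
  low : ∀ (U : Type u) [TopologicalSpace U] (k : ℕ), k < m →
    Bijective (singularCohomology.map R R (ContinuousMap.fst : C(U × Z, U)) k)

namespace IsCupSphere

variable {R}

/-- **Transport along a homeomorphism** `e : Z ≃ₜ Z'`. [folklore] -/
theorem of_homeomorph {Z Z' : Type u} [TopologicalSpace Z] [TopologicalSpace Z'] {m : ℕ} {g' : singularCohomology R R Z' m}
    (h : IsCupSphere R Z' m g') (e : Z ≃ₜ Z') :
    IsCupSphere R Z m (singularCohomology.map R R (e : C(Z, Z')) m g') := by
  have key : ∀ (U : Type u) [TopologicalSpace U] (n : ℕ),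
      Bijective (singularCohomology.map R R ((ContinuousMap.id U).prodMap (e : C(Z, Z'))) n) := fun U _ n ↦
    (singularCohomology.mapIso R R ((Homeomorph.refl U).prodCongr e) n).toLinearEquiv.bijective
  refine ⟨fun U _ k ↦ ?_, fun U _ k hk ↦ ?_⟩
  · have hcomp : sphereSplit R (singularCohomology.map R R (e : C(Z, Z')) m g') U k =
        (singularCohomology.map R R ((ContinuousMap.id U).prodMap (e : C(Z, Z'))) (k + m)) ∘ (sphereSplit R g' U k) := by
      funext ⟨a, c⟩
      simp only [comp_apply, sphereSplit_apply, map_add, cupProduct_map]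
      rw [← ModuleCat.comp_apply, ← singularCohomology.map_comp, ← ModuleCat.comp_apply, ← singularCohomology.map_comp,
        ← ModuleCat.comp_apply, ← singularCohomology.map_comp, ← ModuleCat.comp_apply, ← singularCohomology.map_comp]
      rfl
    rw [hcomp]
    exact (key U (k + m)).comp (h.split U k)
  · have hcomp : (singularCohomology.map R R (ContinuousMap.fst : C(U × Z, U)) k : _ → _) =
        (singularCohomology.map R R ((ContinuousMap.id U).prodMap (e : C(Z, Z'))) k) ∘
          (singularCohomology.map R R (ContinuousMap.fst : C(U × Z', U)) k) := by
      funext a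
      rw [comp_apply, ← ModuleCat.comp_apply, ← singularCohomology.map_comp]
      rfl
    rw [hcomp]
    exact (key U k).comp (h.low U k hk)

/-- **Transport along a homotopy equivalence** `e : Z ≃ₕ Z'`. [cite: HatcherAT2002, §3.1 p. 201] -/
theorem of_homotopyEquiv {Z Z' : Type u} [TopologicalSpace Z] [TopologicalSpace Z'] {m : ℕ} {g' : singularCohomology R R Z' m}
    (h : IsCupSphere R Z' m g') (e : ContinuousMap.HomotopyEquiv Z Z') :
    IsCupSphere R Z m (singularCohomology.map R R e.toFun m g') := by
  have key : ∀ (U : Type u) [TopologicalSpace U] (n : ℕ),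
      Bijective (singularCohomology.map R R ((ContinuousMap.id U).prodMap e.toFun) n) := fun U _ n ↦
    (singularCohomology.isoOfHomotopyEquiv' R R ((ContinuousMap.HomotopyEquiv.refl U).prodCongr e) n).toLinearEquiv.bijective
  refine ⟨fun U _ k ↦ ?_, fun U _ k hk ↦ ?_⟩
  · have hcomp : sphereSplit R (singularCohomology.map R R e.toFun m g') U k =
        (singularCohomology.map R R ((ContinuousMap.id U).prodMap e.toFun) (k + m)) ∘ (sphereSplit R g' U k) := by
      funext ⟨a, c⟩
      simp only [comp_apply, sphereSplit_apply, map_add, cupProduct_map]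
      rw [← ModuleCat.comp_apply, ← singularCohomology.map_comp, ← ModuleCat.comp_apply, ← singularCohomology.map_comp,
        ← ModuleCat.comp_apply, ← singularCohomology.map_comp, ← ModuleCat.comp_apply, ← singularCohomology.map_comp]
      rfl
    rw [hcomp]
    exact (key U (k + m)).comp (h.split U k)
  · have hcomp : (singularCohomology.map R R (ContinuousMap.fst : C(U × Z, U)) k : _ → _) =
        (singularCohomology.map R R ((ContinuousMap.id U).prodMap e.toFun) k) ∘
          (singularCohomology.map R R (ContinuousMap.fst : C(U × Z', U)) k) := by
      funext a
      rw [comp_apply, ← ModuleCat.comp_apply, ← singularCohomology.map_comp]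
      rfl
    rw [hcomp]
    exact (key U k).comp (h.low U k hk)

/-- **The cohomology of a cup-sphere of level `m` vanishes in degrees `≠ 0, m`** (read at
`U = pt`: `Hʲ(pt × Z) = pr₁^* Hʲ(pt) ⊕ pr₂^* g ⌣ pr₁^* Hʲ⁻ᵐ(pt)`, and `Hʲ(pt) = 0` for `j ≠ 0`).
[cite: HatcherAT2002, §3.2 Example 3.11] -/
theorem eq_zero_of_ne {Z : Type u} [TopologicalSpace Z] {m : ℕ} {g : singularCohomology R R Z m} (h : IsCupSphere R Z m g)
    {j : ℕ} (hj0 : j ≠ 0) (hjm : j ≠ m) (x : singularCohomology R R Z j) : x = 0 := by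
  -- `pr₂ : pt × Z → Z` is a homeomorphism, so it suffices that `pr₂^* x = 0`
  have hinj : Injective (singularCohomology.map R R (ContinuousMap.snd : C(PUnit.{u + 1} × Z, Z)) j) :=
    (singularCohomology.mapIso R R (Homeomorph.punitProd Z) j).toLinearEquiv.injective
  have hpt : ∀ {i : ℕ}, i ≠ 0 → ∀ y : singularCohomology R R PUnit.{u + 1} i, y = 0 := fun hi y ↦
    ModuleCat.eq_zero_of_isZero_obj (singularCochainComplex.isZero_singularCohomology_of_subsingleton' (R := R) (M := R) hi) y
  apply hinj
  rw [map_zero]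
  rcases Nat.lt_or_ge j m with hlt | hge
  · obtain ⟨y, hy⟩ := (h.low PUnit.{u + 1} j hlt).2 (singularCohomology.map R R (ContinuousMap.snd : C(PUnit.{u + 1} × Z, Z)) j x)
    rw [← hy, hpt hj0 y, map_zero]
  · obtain ⟨k, rfl⟩ : ∃ k, j = k + m := ⟨j - m, by omega⟩
    have hk : k ≠ 0 := fun hk ↦ hjm (by rw [hk, zero_add])
    obtain ⟨⟨a, c⟩, hac⟩ := (h.split PUnit.{u + 1} k).2 (singularCohomology.map R R (ContinuousMap.snd : C(PUnit.{u + 1} × Z, Z)) (k + m) x)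
    rw [← hac, hpt (by omega) a, hpt hk c, sphereSplit_apply, map_zero, map_zero, LinearMap.map_zero, zero_add]

end IsCupSphere

/-! ### Level `0`: two contractible pieces -/

section Zero

variable {Z : Type u} [TopologicalSpace Z] {P₁ P₂ : Set Z} (hP₁ : IsOpen P₁) (hP₂ : IsOpen P₂)
  (hdisj : Disjoint P₁ P₂) (hcov : P₁ ∪ P₂ = univ) [ContractibleSpace ↥P₁] [ContractibleSpace ↥P₂]

/-- The two-piece clopen partition as a family over `Bool`. [folklore] -/
def boolPieces (P₁ P₂ : Set Z) : Bool → Set Z := fun b ↦ cond b P₂ P₁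

omit [ContractibleSpace ↥P₁] [ContractibleSpace ↥P₂] in
include hP₁ hP₂ hdisj hcov in
/-- It is a clopen partition. [folklore] -/
theorem isClopenPartition_boolPieces : IsClopenPartition (boolPieces P₁ P₂) := by
  refine IsClopenPartition.of_pairwise_disjoint (fun b ↦ by cases b <;> assumption) (fun b b' hbb' ↦ ?_)
    (eq_univ_of_forall fun z ↦ ?_)
  · cases b <;> cases b' <;> simp [boolPieces, onFun] at hbb' ⊢
    · exact hdisj
    · exact hdisj.symm
  · have hz : z ∈ P₁ ∪ P₂ := by rw [hcov]; exact mem_univ z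
    rcases hz with hz | hz
    · exact mem_iUnion.2 ⟨false, hz⟩
    · exact mem_iUnion.2 ⟨true, hz⟩

omit [ContractibleSpace ↥P₁] [ContractibleSpace ↥P₂] in
include hP₁ hP₂ hdisj hcov in
/-- **The indicator class of the second piece**: `g ∈ H⁰(Z)` with `g|P₁ = 0`, `g|P₂ = 1`.
[cite: HatcherAT2002, §3.1 p. 202] -/
theorem exists_indicatorClass : ∃ g : singularCohomology R R Z 0,
    singularCohomology.map R R (subsetIncl P₁) 0 g = 0 ∧ singularCohomology.map R R (subsetIncl P₂) 0 g = singularCohomology.one R ↥P₂ := by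
  obtain ⟨g, hg⟩ := singularCohomology.exists_forall_map_subsetIncl_eq (R := R) (M := R)
    (isClopenPartition_boolPieces hP₁ hP₂ hdisj hcov)
    (fun b ↦ Bool.rec (motive := fun b ↦ singularCohomology R R ↥(boolPieces P₁ P₂ b) 0) 0 (singularCohomology.one R ↥P₂) b)
  exact ⟨g, hg false, hg true⟩

end Zero

/-- **Level `0`**: a disjoint union `Z = P₁ ⊔ P₂` of two contractible open pieces is a cup-sphere
of level `0` for the indicator class `g` of `P₂` (`H*(U × Z) = H*(U × P₁) × H*(U × P₂)` and on the
pieces the map is `(a, c) ↦ (a, a + c)`). [cite: HatcherAT2002, §3.1 p. 202, §3.2 Thm. 3.16] -/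
theorem isCupSphere_zero {Z : Type u} [TopologicalSpace Z] {P₁ P₂ : Set Z} (hP₁ : IsOpen P₁) (hP₂ : IsOpen P₂)
    (hdisj : Disjoint P₁ P₂) (hcov : P₁ ∪ P₂ = univ) [ContractibleSpace ↥P₁] [ContractibleSpace ↥P₂]
    (g : singularCohomology R R Z 0) (hg₁ : singularCohomology.map R R (subsetIncl P₁) 0 g = 0)
    (hg₂ : singularCohomology.map R R (subsetIncl P₂) 0 g = singularCohomology.one R ↥P₂) :
    IsCupSphere R Z 0 g := by
  refine ⟨fun U _ k ↦ ?_, fun U _ k hk ↦ absurd hk (Nat.not_lt_zero k)⟩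
  -- work in degree `k` (`k + 0` reduces to `k`)
  let F : singularCohomology R R U k × singularCohomology R R U k → singularCohomology R R (U × Z) k := fun x ↦
    singularCohomology.map R R (ContinuousMap.fst : C(U × Z, U)) k x.1 +
      cupProduct (Nat.zero_add k) (singularCohomology.map R R (ContinuousMap.snd : C(U × Z, Z)) 0 g)
        (singularCohomology.map R R (ContinuousMap.fst : C(U × Z, U)) k x.2)
  change Bijective F
  -- the partition of `U × Z`
  have hA : IsClopenPartition (boolPieces (vert U P₁) (vert U P₂)) :=
    isClopenPartition_boolPieces (isOpen_vert hP₁) (isOpen_vert hP₂) (hdisj.preimage _)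
      (by rw [← preimage_union, hcov, preimage_univ])
  have hres := singularCohomology.piRestrict_bijective (R := R) (M := R) hA k
  -- the second factor on the pieces
  have hsnd₁ : singularCohomology.map R R (subsetIncl (vert U P₁)) 0
      (singularCohomology.map R R (ContinuousMap.snd : C(U × Z, Z)) 0 g) = 0 := by
    have : (ContinuousMap.snd : C(U × Z, Z)).comp (subsetIncl (vert U P₁)) =
        (subsetIncl P₁).comp ⟨fun p ↦ ⟨p.1.2, p.2⟩, (continuous_snd.comp continuous_subtype_val).subtype_mk _⟩ := rfl
    rw [← ModuleCat.comp_apply, ← singularCohomology.map_comp, this, singularCohomology.map_comp, ModuleCat.comp_apply, hg₁,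
      map_zero]
  have hsnd₂ : singularCohomology.map R R (subsetIncl (vert U P₂)) 0
      (singularCohomology.map R R (ContinuousMap.snd : C(U × Z, Z)) 0 g) = singularCohomology.one R ↥(vert U P₂) := by
    have : (ContinuousMap.snd : C(U × Z, Z)).comp (subsetIncl (vert U P₂)) =
        (subsetIncl P₂).comp ⟨fun p ↦ ⟨p.1.2, p.2⟩, (continuous_snd.comp continuous_subtype_val).subtype_mk _⟩ := rfl
    rw [← ModuleCat.comp_apply, ← singularCohomology.map_comp, this, singularCohomology.map_comp, ModuleCat.comp_apply, hg₂,
      singularCohomology.map_one]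
  -- restriction of `F` to the two pieces
  have hr₁ : ∀ a c, singularCohomology.map R R (subsetIncl (vert U P₁)) k (F (a, c)) =
      singularCohomology.map R R (fstVert U P₁) k a := fun a c ↦ by
    simp only [F, map_add, cupProduct_map]
    rw [hsnd₁, LinearMap.map_zero₂, add_zero, map_subsetIncl_map_fst]
  have hr₂ : ∀ a c, singularCohomology.map R R (subsetIncl (vert U P₂)) k (F (a, c)) =
      singularCohomology.map R R (fstVert U P₂) k (a + c) := fun a c ↦ by
    simp only [F, map_add, cupProduct_map]
    rw [hsnd₂, one_cupProduct, map_subsetIncl_map_fst, map_subsetIncl_map_fst]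
  -- `fstVert` is bijective (contractible pieces)
  have hb₁ := map_fstVert_bijective R R (U := U) (Y₁ := P₁) k
  have hb₂ := map_fstVert_bijective R R (U := U) (Y₁ := P₂) k
  constructor
  · rintro ⟨a, c⟩ ⟨a', c'⟩ hxx'
    have e₁ := congrArg (singularCohomology.map R R (subsetIncl (vert U P₁)) k) hxx'
    have e₂ := congrArg (singularCohomology.map R R (subsetIncl (vert U P₂)) k) hxx'
    rw [hr₁, hr₁] at e₁
    rw [hr₂, hr₂] at e₂
    have h1 : a = a' := hb₁.1 e₁
    have h2 : a + c = a' + c' := hb₂.1 e₂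
    rw [h1] at h2
    exact Prod.ext h1 (add_left_cancel h2)
  · intro y
    obtain ⟨a, ha⟩ := hb₁.2 (singularCohomology.map R R (subsetIncl (vert U P₁)) k y)
    obtain ⟨t, ht⟩ := hb₂.2 (singularCohomology.map R R (subsetIncl (vert U P₂)) k y)
    refine ⟨(a, t - a), hres.1 (funext fun b ↦ ?_)⟩
    cases b
    · change singularCohomology.map R R (subsetIncl (vert U P₁)) k (F (a, t - a)) =
        singularCohomology.map R R (subsetIncl (vert U P₁)) k y
      rw [hr₁, ha]
    · change singularCohomology.map R R (subsetIncl (vert U P₂)) k (F (a, t - a)) =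
        singularCohomology.map R R (subsetIncl (vert U P₂)) k y
      rw [hr₂, add_sub_cancel, ht]

/-! ### The suspension step -/

section Suspension

variable {Y : Type u} [TopologicalSpace Y] {A₁ A₂ : Set Y} (h₁ : IsOpen A₁) (h₂ : IsOpen A₂) (hcov : A₁ ∪ A₂ = univ)
  [ContractibleSpace ↥A₁] [ContractibleSpace ↥A₂] {z₀ : Y} (hz₀ : z₀ ∈ A₁ ∩ A₂)

/-- `↥(U × (A₁ ∩ A₂)) → ↥(A₁ ∩ A₂)`, the second projection in the coordinates of `interHomeomorph`. [folklore] -/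
def sndZ (U : Type u) [TopologicalSpace U] (A₁ A₂ : Set Y) : C(↥(inter U A₁ A₂), ↥(A₁ ∩ A₂)) :=
  (ContinuousMap.snd : C(U × ↥(A₁ ∩ A₂), ↥(A₁ ∩ A₂))).comp (interHomeomorph U A₁ A₂ : C(↥(inter U A₁ A₂), _))

/-- The constant map to the point. [folklore] -/
abbrev toPt (U : Type u) [TopologicalSpace U] : C(U, PUnit.{u + 1}) := ContinuousMap.const U PUnit.unit

/-- `Y ≃ₜ pt × Y`. [folklore] -/
abbrev ptProd (Y : Type u) [TopologicalSpace Y] : Y ≃ₜ PUnit.{u + 1} × Y := (Homeomorph.punitProd Y).symm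

/-- **The suspended class** `g_Y = κ_{pt}(pr₂^* g) ∈ Hᵐ⁺¹(Y)` (read on `Y ≅ pt × Y`).
[cite: HatcherAT2002, §3.2 Thm. 3.16 (proof)] -/
def suspCls {m : ℕ} (g : singularCohomology R R ↥(A₁ ∩ A₂) m) : singularCohomology R R Y (m + 1) :=
  singularCohomology.map R R (ptProd Y : C(Y, PUnit.{u + 1} × Y)) (m + 1)
    (twoPieceKappa R R (U := PUnit.{u + 1}) h₁ h₂ hcov m (singularCohomology.map R R (sndZ PUnit.{u + 1} A₁ A₂) m g))

omit [ContractibleSpace ↥A₁] [ContractibleSpace ↥A₂] in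
/-- **`pr₂^* g_Y = κ_U(pr₂^* g)`** on `U × Y` (naturality of `κ` along `U → pt`).
[cite: HatcherAT2002, §3.1 p. 200] -/
theorem map_snd_suspCls {m : ℕ} (g : singularCohomology R R ↥(A₁ ∩ A₂) m) (U : Type u) [TopologicalSpace U] :
    singularCohomology.map R R (ContinuousMap.snd : C(U × Y, Y)) (m + 1) (suspCls R h₁ h₂ hcov g) =
      twoPieceKappa R R (U := U) h₁ h₂ hcov m (singularCohomology.map R R (sndZ U A₁ A₂) m g) := by
  have hsnd : (ContinuousMap.snd : C(U × Y, Y)) =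
      ((Homeomorph.punitProd Y : C(PUnit.{u + 1} × Y, Y)).comp (prodMapId (toPt U))) := by
    ext ⟨u, y⟩; rfl
  have hid : ((ptProd Y : C(Y, PUnit.{u + 1} × Y)).comp (Homeomorph.punitProd Y : C(PUnit.{u + 1} × Y, Y))) =
      ContinuousMap.id _ := by
    ext ⟨u, y⟩; rfl
  have e1 : ∀ z : singularCohomology R R (PUnit.{u + 1} × Y) (m + 1),
      singularCohomology.map R R (Homeomorph.punitProd Y : C(PUnit.{u + 1} × Y, Y)) (m + 1)
        (singularCohomology.map R R (ptProd Y : C(Y, PUnit.{u + 1} × Y)) (m + 1) z) = z := fun z ↦ by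
    rw [← ModuleCat.comp_apply, ← singularCohomology.map_comp, hid, singularCohomology.map_id]
    rfl
  rw [suspCls, hsnd, singularCohomology.map_comp, ModuleCat.comp_apply, e1, map_prodMapId_twoPieceKappa]
  congr 1
  rw [← ModuleCat.comp_apply, ← singularCohomology.map_comp]
  rfl

omit [ContractibleSpace ↥A₁] [ContractibleSpace ↥A₂] in
/-- `fstInter = pr₁ ∘ j` with `j` the inclusion `↥(U × Z) → U × Y`. [folklore] -/
theorem fstInter_eq_fst_comp_interIncl (U : Type u) [TopologicalSpace U] :
    fstInter U A₁ A₂ = (ContinuousMap.fst : C(U × Y, U)).comp (interIncl U A₁ A₂) := rfl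

omit [ContractibleSpace ↥A₁] [ContractibleSpace ↥A₂] in
/-- **The key identity**: `κ_U(pr₂^* g ⌣ pr₁^* c) = pr₂^* g_Y ⌣ pr₁^* c` (linearity of `κ` over
`H*(U × Y)` and the previous lemma). [cite: HatcherAT2002, §3.2 Thm. 3.16 (proof)] -/
theorem twoPieceKappa_sndZ_cup {m k : ℕ} (g : singularCohomology R R ↥(A₁ ∩ A₂) m) (U : Type u) [TopologicalSpace U]
    (c : singularCohomology R R U k) :
    twoPieceKappa R R (U := U) h₁ h₂ hcov (k + m)
        (cupProduct (Nat.add_comm m k) (singularCohomology.map R R (sndZ U A₁ A₂) m g)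
          (singularCohomology.map R R (fstInter U A₁ A₂) k c)) =
      cupProduct (show (m + 1) + k = k + m + 1 by omega)
        (singularCohomology.map R R (ContinuousMap.snd : C(U × Y, Y)) (m + 1) (suspCls R h₁ h₂ hcov g))
        (singularCohomology.map R R (ContinuousMap.fst : C(U × Y, U)) k c) := by
  have e := map_snd_suspCls R h₁ h₂ hcov g U
  have e2 : fstInter U A₁ A₂ = (ContinuousMap.fst : C(U × Y, U)).comp (interIncl U A₁ A₂) := rfl
  rw [e, e2, singularCohomology.map_comp, ModuleCat.comp_apply]
  exact twoPieceKappa_cupProduct (U := U) R h₁ h₂ hcov (Nat.add_comm m k) _ _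

omit [ContractibleSpace ↥A₁] [ContractibleSpace ↥A₂] in
/-- Classes on `↥(U × Z)` pulled back from `U × ↥Z` along `interHomeomorph`: `pr₁^*` becomes
`fstInter^*`, `pr₂^*` becomes `sndZ^*`. [folklore] -/
theorem map_interHomeomorph_sphereSplit {m : ℕ} (g : singularCohomology R R ↥(A₁ ∩ A₂) m) (U : Type u) [TopologicalSpace U]
    (k : ℕ) (a : singularCohomology R R U (k + m)) (c : singularCohomology R R U k) :
    singularCohomology.map R R (interHomeomorph U A₁ A₂ : C(↥(inter U A₁ A₂), U × ↥(A₁ ∩ A₂))) (k + m)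
        (sphereSplit R g U k (a, c)) =
      singularCohomology.map R R (fstInter U A₁ A₂) (k + m) a +
        cupProduct (Nat.add_comm m k) (singularCohomology.map R R (sndZ U A₁ A₂) m g)
          (singularCohomology.map R R (fstInter U A₁ A₂) k c) := by
  rw [sphereSplit_apply, map_add, cupProduct_map, ← ModuleCat.comp_apply, ← singularCohomology.map_comp,
    ← ModuleCat.comp_apply, ← singularCohomology.map_comp, ← ModuleCat.comp_apply, ← singularCohomology.map_comp]
  rfl

include hz₀ in
/-- **The suspension step**: if `A₁ ∩ A₂` is a cup-sphere of level `m` (for `g`), then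
`Y = A₁ ∪ A₂` (`Aᵢ` open contractible) is a cup-sphere of level `m + 1` for `g_Y`.
[cite: HatcherAT2002, §3.2 Thm. 3.16 (proof), Example 3.11] -/
theorem IsCupSphere.suspension {m : ℕ} {g : singularCohomology R R ↥(A₁ ∩ A₂) m} (hZ : IsCupSphere R ↥(A₁ ∩ A₂) m g) :
    IsCupSphere R Y (m + 1) (suspCls R h₁ h₂ hcov g) := by
  have hy₁ : z₀ ∈ A₁ := hz₀.1
  -- the homeomorphism `↥(U × Z) ≅ U × ↥Z` on cohomology
  have hinj : ∀ (U : Type u) [TopologicalSpace U] (n : ℕ), Injective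
      (singularCohomology.map R R (interHomeomorph U A₁ A₂ : C(↥(inter U A₁ A₂), U × ↥(A₁ ∩ A₂))) n) := fun U _ n ↦
    (singularCohomology.mapIso R R (interHomeomorph U A₁ A₂) n).toLinearEquiv.injective
  have hsurj : ∀ (U : Type u) [TopologicalSpace U] (n : ℕ), Surjective
      (singularCohomology.map R R (interHomeomorph U A₁ A₂ : C(↥(inter U A₁ A₂), U × ↥(A₁ ∩ A₂))) n) := fun U _ n ↦
    (singularCohomology.mapIso R R (interHomeomorph U A₁ A₂) n).toLinearEquiv.surjective
  refine ⟨fun U _ k ↦ ?_, fun U _ k hk ↦ ?_⟩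
  · -- the splitting in degree `k + (m + 1)`, read in degree `(k + m) + 1`
    let F : singularCohomology R R U (k + m + 1) × singularCohomology R R U k → singularCohomology R R (U × Y) (k + m + 1) :=
      fun x ↦ singularCohomology.map R R (ContinuousMap.fst : C(U × Y, U)) (k + m + 1) x.1 +
        cupProduct (show (m + 1) + k = k + m + 1 by omega)
          (singularCohomology.map R R (ContinuousMap.snd : C(U × Y, Y)) (m + 1) (suspCls R h₁ h₂ hcov g))
          (singularCohomology.map R R (ContinuousMap.fst : C(U × Y, U)) k x.2)
    change Bijective F
    have hF : ∀ a c, F (a, c) = singularCohomology.map R R (ContinuousMap.fst : C(U × Y, U)) (k + m + 1) a +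
        twoPieceKappa R R (U := U) h₁ h₂ hcov (k + m)
          (cupProduct (Nat.add_comm m k) (singularCohomology.map R R (sndZ U A₁ A₂) m g)
            (singularCohomology.map R R (fstInter U A₁ A₂) k c)) := fun a c ↦ by
      rw [twoPieceKappa_sndZ_cup]
    constructor
    · -- injectivity
      rintro ⟨a, c⟩ ⟨a', c'⟩ hxx'
      rw [hF, hF] at hxx'
      obtain ⟨haa', hκ⟩ := eq_of_map_fst_add_twoPieceKappa_eq R R h₁ h₂ hcov (k + m) hxx'
      subst haa'
      have hκ0 : twoPieceKappa R R (U := U) h₁ h₂ hcov (k + m)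
          (cupProduct (Nat.add_comm m k) (singularCohomology.map R R (sndZ U A₁ A₂) m g)
            (singularCohomology.map R R (fstInter U A₁ A₂) k (c - c'))) = 0 := by
        rw [map_sub, LinearMap.map_sub, map_sub, hκ, sub_self]
      obtain ⟨w, hw⟩ := (twoPieceKappa_eq_zero_iff R R h₁ h₂ hcov (k + m) _).1 hκ0
      change singularCohomology.map R R (fstInter U A₁ A₂) (k + m) w = _ at hw
      -- read in `U × ↥Z`: `sphereSplit g (-w, c - c') = sphereSplit g (0, 0)`
      have hzero : sphereSplit R g U k (-w, c - c') = sphereSplit R g U k (0, 0) := by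
        apply hinj U (k + m)
        rw [map_interHomeomorph_sphereSplit, map_interHomeomorph_sphereSplit, ← hw, map_neg, map_zero, map_zero,
          LinearMap.map_zero]
        abel
      have := congrArg Prod.snd ((hZ.split U k).1 hzero)
      exact Prod.ext rfl (sub_eq_zero.1 this)
    · -- surjectivity
      intro y
      obtain ⟨b, hb⟩ := exists_eq_map_fst_add_twoPieceKappa R R h₁ h₂ hcov hz₀ hy₁ (k + m) y
      obtain ⟨b', rfl⟩ := hsurj U (k + m) b
      obtain ⟨⟨a₁, c⟩, rfl⟩ := (hZ.split U k).2 b'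
      refine ⟨(singularCohomology.map R R (sliceAt z₀) (k + m + 1) y, c), ?_⟩
      rw [hF]
      conv_rhs => rw [hb]
      rw [map_interHomeomorph_sphereSplit, map_add, (twoPieceKappa_eq_zero_iff R R h₁ h₂ hcov (k + m) _).2 ⟨a₁, rfl⟩, zero_add]
  · -- low degrees
    refine ⟨Function.LeftInverse.injective fun x ↦ map_sliceAt_map_fst R R (C := Y) z₀ k x, fun y ↦ ?_⟩
    cases k with
    | zero => exact (map_fst_bijective_zero R R h₁ h₂ hcov hz₀).2 y
    | succ i =>
      obtain ⟨b, hb⟩ := exists_eq_map_fst_add_twoPieceKappa R R h₁ h₂ hcov hz₀ hy₁ i y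
      obtain ⟨b', rfl⟩ := hsurj U i b
      obtain ⟨a₁, rfl⟩ := (hZ.low U i (by omega)).2 b'
      have hmem : singularCohomology.map R R (interHomeomorph U A₁ A₂ : C(↥(inter U A₁ A₂), U × ↥(A₁ ∩ A₂))) i
          (singularCohomology.map R R (ContinuousMap.fst : C(U × ↥(A₁ ∩ A₂), U)) i a₁) ∈
            LinearMap.range (singularCohomology.map R R (fstInter U A₁ A₂) i).hom := by
        refine ⟨a₁, ?_⟩
        change singularCohomology.map R R (fstInter U A₁ A₂) i a₁ = _
        rw [← ModuleCat.comp_apply, ← singularCohomology.map_comp]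
        rfl
      refine ⟨singularCohomology.map R R (sliceAt z₀) (i + 1) y, ?_⟩
      conv_rhs => rw [hb]
      rw [(twoPieceKappa_eq_zero_iff R R h₁ h₂ hcov i _).2 hmem, add_zero]

end Suspension

end Literature.AlgebraicTopology.SingularHomology
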